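import Mathlib.Analysis.Calculus.InverseFunctionTheorem.Deriv
import Mathlib.Analysis.Calculus.ContDiff.RCLike
import Literature.Analysis.Complex.LengthArea
import HarnessLib

/-!
# The area formula with multiplicity for holomorphic maps of one variable

For a holomorphic map `α` of an open set `U ⊆ ℂ` the real Jacobian is `‖α'‖²`
(`Literature.Analysis.Complex.LengthArea.det_restrictScalars_smulRight`), and Mathlib's change of
variables (`MeasureTheory.lintegral_abs_det_fderiv_eq_addHaar_image`) gives, for `α` INJECTIVE on
a measurable `s ⊆ U`, `∫_s ‖α'‖² = area (α s)`. This file removes the injectivity hypothesis in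
the form of the **area formula with multiplicity** (Federer, *Geometric Measure Theory* (1969),
Thm. 3.2.3; Rudin, *Real and Complex Analysis*, Thm. 7.26 and its use in Thm. 10.?; Evans–Gariepy,
§3.3 Thm. 1: `∫_s J_α = ∫ N(α|s, w) dw`, `N` the number of preimages), in the inequality form
that is consumed downstream (Lelong-type area bounds for analytic curves,
`Literature/Geometry/Kaehler/AnalyticCurveSheets.lean`):

* `exists_isOpen_injOn_of_deriv_ne_zero` — a holomorphic map is injective near a point where
  its derivative does not vanish (inverse function theorem);
* `exists_seq_isOpen_injOn` — the set `{α' ≠ 0}` is covered by countably many open sets on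
  each of which `α` is injective (Lindelöf);
* `tsum_lintegral_norm_deriv_sq_le` — for a countable family of holomorphic maps `α i` on open
  sets `U i` and measurable `s i ⊆ U i` mapped into a measurable `W`, if every `w ∈ W` has at
  most `d` preimages `(i, z)`, `z ∈ s i`, `α i z = w`, then
  `Σ_i ∫_{s i} ‖(α i)'‖² ≤ d · area W`; `lintegral_norm_deriv_sq_le` is the case of one map.

Proof: discard `{α' = 0}` (the integrand vanishes there; no Sard lemma is needed), partition the
rest into countably many measurable pieces on which the map is injective, apply the injective
formula on each piece and count: a point `w` lies in the images of at most `d` pieces.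

## References

* H. Federer, *Geometric Measure Theory*, Springer 1969, Thm. 3.2.3 (area formula). [Federer1969]
* L. C. Evans, R. F. Gariepy, *Measure Theory and Fine Properties of Functions*, CRC 1992,
  §3.3 Thm. 1 and §3.3.3 (change of variables with the multiplicity function).
-/

noncomputable section

open Set Filter Metric Topology MeasureTheory Complex
open scoped ENNReal NNReal

namespace Literature.Analysis.Complex

namespace AreaMultiplicity

variable {α : ℂ → ℂ} {U : Set ℂ}

/-! ### Local injectivity where the derivative does not vanish -/

/-- **A holomorphic map is injective near a point where its derivative is non-zero** (inverse
function theorem; the derivative of a holomorphic map is a strict derivative). [folklore] -/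
theorem exists_isOpen_injOn_of_deriv_ne_zero (hU : IsOpen U) (hα : DifferentiableOn ℂ α U)
    {z : ℂ} (hz : z ∈ U) (hz' : deriv α z ≠ 0) :
    ∃ V : Set ℂ, IsOpen V ∧ z ∈ V ∧ V ⊆ U ∧ InjOn α V := by
  have han : AnalyticAt ℂ α z := hα.analyticAt (hU.mem_nhds hz)
  have hstrict : HasStrictDerivAt α (deriv α z) z :=
    han.contDiffAt.hasStrictDerivAt one_ne_zero
  have hleft := hstrict.eventually_left_inverse hz'
  obtain ⟨V, hVsub, hVo, hzV⟩ := _root_.eventually_nhds_iff.1 (hleft.and (hU.mem_nhds hz))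
  refine ⟨V, hVo, hzV, fun x hx => (hVsub x hx).2, fun x hx y hy hxy => ?_⟩
  rw [← (hVsub x hx).1, ← (hVsub y hy).1, hxy]

/-- **Countably many injectivity charts** (Lindelöf): there is a sequence of open subsets of `U`,
on each of which `α` is injective, covering the points of `U` where `α' ≠ 0`. [folklore] -/
theorem exists_seq_isOpen_injOn (hU : IsOpen U) (hα : DifferentiableOn ℂ α U) :
    ∃ V : ℕ → Set ℂ, (∀ n, IsOpen (V n)) ∧ (∀ n, V n ⊆ U) ∧ (∀ n, InjOn α (V n)) ∧
      ∀ z ∈ U, deriv α z ≠ 0 → ∃ n, z ∈ V n := by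
  set S : Set (Set ℂ) := {V | IsOpen V ∧ V ⊆ U ∧ InjOn α V} with hS
  obtain ⟨T, hTc, hTS, hTU⟩ := TopologicalSpace.isOpen_sUnion_countable S fun V hV => hV.1
  have hT'c : (insert ∅ T).Countable := hTc.insert ∅
  obtain ⟨V, hV⟩ := hT'c.exists_eq_range (insert_nonempty ∅ T)
  have hVmem : ∀ n, V n ∈ insert ∅ T := fun n => hV ▸ mem_range_self n
  have hprop : ∀ n, IsOpen (V n) ∧ V n ⊆ U ∧ InjOn α (V n) := by
    intro n
    rcases hVmem n with h | h
    · rw [h]; exact ⟨isOpen_empty, empty_subset _, injOn_empty α⟩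
    · exact hTS h
  refine ⟨V, fun n => (hprop n).1, fun n => (hprop n).2.1, fun n => (hprop n).2.2,
    fun z hz hz' => ?_⟩
  obtain ⟨W, hWo, hzW, hWU, hWinj⟩ := exists_isOpen_injOn_of_deriv_ne_zero hU hα hz hz'
  have hzS : z ∈ ⋃₀ S := ⟨W, ⟨hWo, hWU, hWinj⟩, hzW⟩
  rw [← hTU] at hzS
  obtain ⟨W', hW'T, hzW'⟩ := hzS
  have : W' ∈ range V := by rw [← hV]; exact mem_insert_of_mem _ hW'T
  obtain ⟨n, rfl⟩ := this
  exact ⟨n, hzW'⟩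

/-! ### The Jacobian `‖α'‖²` and the injective area formula -/

/-- The real derivative of a holomorphic map, as needed by Mathlib's change of variables: within
any `s ⊆ U`, `α` has Fréchet derivative "multiplication by `α' z`". [folklore] -/
theorem hasFDerivWithinAt_restrictScalars (hU : IsOpen U) (hα : DifferentiableOn ℂ α U)
    {s : Set ℂ} (hsU : s ⊆ U) {z : ℂ} (hz : z ∈ s) :
    HasFDerivWithinAt α
      ((ContinuousLinearMap.smulRight (1 : ℂ →L[ℂ] ℂ) (deriv α z)).restrictScalars ℝ) s z :=
  ((hα.differentiableAt (hU.mem_nhds (hsU hz))).hasDerivAt.hasFDerivAt.restrictScalars ℝ)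
    |>.hasFDerivWithinAt

/-- **Injective area formula** for a holomorphic map on a measurable set:
`∫_s ‖α'‖² = area (α s)`. [cite: Federer1969, Thm. 3.2.3] -/
theorem lintegral_norm_deriv_sq_eq_volume_image (hU : IsOpen U) (hα : DifferentiableOn ℂ α U)
    {s : Set ℂ} (hs : MeasurableSet s) (hsU : s ⊆ U) (hinj : InjOn α s) :
    ∫⁻ z in s, ENNReal.ofReal (‖deriv α z‖ ^ 2) = volume (α '' s) := by
  rw [← lintegral_abs_det_fderiv_eq_addHaar_image volume hs
    (fun z hz => hasFDerivWithinAt_restrictScalars hU hα hsU hz) hinj]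
  refine setLIntegral_congr_fun hs fun z _ => ?_
  rw [LengthArea.det_restrictScalars_smulRight, abs_of_nonneg (by positivity)]

/-- The image of a measurable set by an injective holomorphic map is measurable. [folklore] -/
theorem measurableSet_image (hU : IsOpen U) (hα : DifferentiableOn ℂ α U)
    {s : Set ℂ} (hs : MeasurableSet s) (hsU : s ⊆ U) (hinj : InjOn α s) :
    MeasurableSet (α '' s) :=
  measurable_image_of_fderivWithin hs
    (fun _ hz => hasFDerivWithinAt_restrictScalars hU hα hsU hz) hinj

/-! ### The area formula with multiplicity -/

section Family

variable {ι : Type*} [Countable ι] {a : ι → ℂ → ℂ} {V : ι → Set ℂ}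

omit [Countable ι] in
/-- Counting step: if the sets `P k` are pairwise disjoint in the sense that a point of `s i`
lies in at most one `P (i, n)`, and every `w ∈ W` has at most `d` preimages `(i, z)` with
`z ∈ s i`, then `w` lies in at most `d` of the images `a i '' (s i ∩ P (i, n))`. [folklore] -/
theorem sum_indicator_image_le {s : ι → Set ℂ} {P : ι × ℕ → Set ℂ}
    (hP : ∀ i n m z, z ∈ P (i, n) → z ∈ P (i, m) → n = m) {W : Set ℂ} {d : ℕ}
    (hd : ∀ w ∈ W, ∃ t : Finset (ι × ℂ), t.card ≤ d ∧
      ∀ i z, z ∈ s i → a i z = w → (i, z) ∈ t)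
    (hW : ∀ i, MapsTo (a i) (s i) W) (F : Finset (ι × ℕ)) (w : ℂ) :
    ∑ k ∈ F, (a k.1 '' (s k.1 ∩ P k)).indicator (1 : ℂ → ℝ≥0∞) w ≤
      d * W.indicator (1 : ℂ → ℝ≥0∞) w := by
  classical
  by_cases hw : w ∈ W
  · rw [indicator_of_mem hw, Pi.one_apply, mul_one]
    obtain ⟨t, htd, ht⟩ := hd w hw
    -- the pieces whose image contains `w`
    set G := F.filter fun k => w ∈ a k.1 '' (s k.1 ∩ P k) with hG
    have hsum : ∑ k ∈ F, (a k.1 '' (s k.1 ∩ P k)).indicator (1 : ℂ → ℝ≥0∞) w = (G.card : ℝ≥0∞) := by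
      rw [Finset.card_eq_sum_ones, Nat.cast_sum, Finset.sum_filter]
      refine Finset.sum_congr rfl fun k _ => ?_
      by_cases hk : w ∈ a k.1 '' (s k.1 ∩ P k)
      · rw [indicator_of_mem hk, if_pos hk]; simp
      · rw [indicator_of_notMem hk, if_neg hk]
    rw [hsum]
    -- choose a preimage in each such piece; the choice is injective
    have hex : ∀ k ∈ G, ∃ z, z ∈ s k.1 ∩ P k ∧ a k.1 z = w := fun k hk => by
      obtain ⟨z, hz, hzw⟩ := (Finset.mem_filter.1 hk).2
      exact ⟨z, hz, hzw⟩
    choose! ζ hζmem hζw using hex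
    have hinj : Set.InjOn (fun k => (k.1, ζ k)) G := by
      intro k hk k' hk' hkk'
      simp only [Prod.mk.injEq] at hkk'
      obtain ⟨h1, h2⟩ := hkk'
      have hzP : ζ k ∈ P k := (hζmem k hk).2
      have hzP' : ζ k ∈ P (k.1, k'.2) := by
        have := (hζmem k' hk').2
        rw [← h2] at this
        rwa [show k' = (k.1, k'.2) from Prod.ext h1.symm rfl] at this
      have hn : k.2 = k'.2 := hP k.1 k.2 k'.2 (ζ k) (by rw [Prod.mk.eta]; exact hzP) hzP'
      exact Prod.ext h1 hn
    have hmaps : ∀ k ∈ G, (fun k => (k.1, ζ k)) k ∈ t := fun k hk =>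
      ht k.1 (ζ k) (hζmem k hk).1 (hζw k hk)
    have hcard : G.card ≤ t.card := Finset.card_le_card_of_injOn _ hmaps hinj
    exact_mod_cast hcard.trans htd
  · rw [indicator_of_notMem hw, mul_zero, nonpos_iff_eq_zero]
    refine Finset.sum_eq_zero fun k _ => indicator_of_notMem (fun h => hw ?_) _
    obtain ⟨z, hz, rfl⟩ := h
    exact hW k.1 hz.1

/-- **Area formula with multiplicity, family form.** Let `a i` (`i` in a countable index type) be
holomorphic on open sets `V i ⊆ ℂ`, let `s i ⊆ V i` be measurable with `a i (s i) ⊆ W`, `W`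
measurable, and suppose every `w ∈ W` has at most `d` preimages, i.e. at most `d` pairs
`(i, z)` with `z ∈ s i` and `a i z = w`. Then `Σ_i ∫_{s i} ‖(a i)'‖² ≤ d · area W`.
(Federer (1969), Thm. 3.2.3: `∫ J = ∫ N`; here the multiplicity `N ≤ d` on `W`.)
[cite: Federer1969, Thm. 3.2.3] -/
theorem tsum_lintegral_norm_deriv_sq_le (hV : ∀ i, IsOpen (V i))
    (ha : ∀ i, DifferentiableOn ℂ (a i) (V i)) {s : ι → Set ℂ} (hs : ∀ i, MeasurableSet (s i))
    (hsV : ∀ i, s i ⊆ V i) {W : Set ℂ} (hWm : MeasurableSet W) (hW : ∀ i, MapsTo (a i) (s i) W)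
    {d : ℕ} (hd : ∀ w ∈ W, ∃ t : Finset (ι × ℂ), t.card ≤ d ∧
      ∀ i z, z ∈ s i → a i z = w → (i, z) ∈ t) :
    ∑' i, ∫⁻ z in s i, ENNReal.ofReal (‖deriv (a i) z‖ ^ 2) ≤ d * volume W := by
  classical
  -- injectivity charts for each map
  choose Q hQo hQV hQinj hQcov using fun i => exists_seq_isOpen_injOn (hV i) (ha i)
  -- disjoint measurable pieces `P (i, n) ⊆ Q i n`
  set P : ι × ℕ → Set ℂ := fun k => disjointed (Q k.1) k.2 with hPdef
  have hPmeas : ∀ k, MeasurableSet (P k) := fun k =>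
    MeasurableSet.disjointed (fun n => (hQo k.1 n).measurableSet) k.2
  have hPsub : ∀ k, P k ⊆ Q k.1 k.2 := fun k => disjointed_subset _ _
  have hPdisj : ∀ i n m z, z ∈ P (i, n) → z ∈ P (i, m) → n = m := by
    intro i n m z hn hm
    by_contra hnm
    exact Set.disjoint_left.1 (disjoint_disjointed (Q i) hnm) hn hm
  -- the good part `s i ∩ {a' ≠ 0}` is covered by the pieces
  have hcover : ∀ i, s i ∩ {z | deriv (a i) z ≠ 0} ⊆ ⋃ n, s i ∩ P (i, n) := by
    intro i z ⟨hz, hz'⟩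
    obtain ⟨n, hn⟩ := hQcov i z (hsV i hz) hz'
    have : z ∈ ⋃ n, disjointed (Q i) n := by rw [iUnion_disjointed]; exact mem_iUnion.2 ⟨n, hn⟩
    obtain ⟨m, hm⟩ := mem_iUnion.1 this
    exact mem_iUnion.2 ⟨m, hz, hm⟩
  -- Step 1: for each `i`, `∫_{s i} ‖a'‖² ≤ Σ_n area (a i '' (s i ∩ P (i,n)))`
  have hstep : ∀ i, ∫⁻ z in s i, ENNReal.ofReal (‖deriv (a i) z‖ ^ 2) ≤
      ∑' n, volume (a i '' (s i ∩ P (i, n))) := by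
    intro i
    have hzero : ∫⁻ z in s i \ {z | deriv (a i) z ≠ 0}, ENNReal.ofReal (‖deriv (a i) z‖ ^ 2) = 0 := by
      refine (setLIntegral_congr_fun_ae ((hs i).diff ?_) ?_).trans lintegral_zero
      · exact (measurable_deriv (a i)) (measurableSet_singleton 0).compl
      · refine Eventually.of_forall fun z hz => ?_
        have : deriv (a i) z = 0 := by simpa using hz.2
        simp [this]
    have hmeas0 : MeasurableSet {z | deriv (a i) z ≠ 0} :=
      (measurable_deriv (a i)) (measurableSet_singleton 0).compl
    calc ∫⁻ z in s i, ENNReal.ofReal (‖deriv (a i) z‖ ^ 2)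
        = (∫⁻ z in s i ∩ {z | deriv (a i) z ≠ 0}, ENNReal.ofReal (‖deriv (a i) z‖ ^ 2)) +
            ∫⁻ z in s i \ {z | deriv (a i) z ≠ 0}, ENNReal.ofReal (‖deriv (a i) z‖ ^ 2) :=
          (lintegral_inter_add_sdiff (μ := volume)
            (fun z => ENNReal.ofReal (‖deriv (a i) z‖ ^ 2)) (s i) hmeas0).symm
      _ = ∫⁻ z in s i ∩ {z | deriv (a i) z ≠ 0}, ENNReal.ofReal (‖deriv (a i) z‖ ^ 2) := by
          rw [hzero, add_zero]
      _ ≤ ∫⁻ z in ⋃ n, s i ∩ P (i, n), ENNReal.ofReal (‖deriv (a i) z‖ ^ 2) :=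
          lintegral_mono_set (hcover i)
      _ = ∑' n, ∫⁻ z in s i ∩ P (i, n), ENNReal.ofReal (‖deriv (a i) z‖ ^ 2) := by
          refine lintegral_iUnion (fun n => (hs i).inter (hPmeas (i, n))) ?_ _
          intro n m hnm
          exact Disjoint.mono inter_subset_right inter_subset_right
            (disjoint_disjointed (Q i) hnm)
      _ = ∑' n, volume (a i '' (s i ∩ P (i, n))) := by
          refine tsum_congr fun n => ?_
          exact lintegral_norm_deriv_sq_eq_volume_image (hV i) (ha i)
            ((hs i).inter (hPmeas (i, n)))
            (inter_subset_left.trans (hsV i))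
            ((hQinj i n).mono (inter_subset_right.trans (hPsub (i, n))))
  -- Step 2: sum over `i` and count multiplicities
  have himeas : ∀ k : ι × ℕ, MeasurableSet (a k.1 '' (s k.1 ∩ P k)) := fun k =>
    measurableSet_image (hV k.1) (ha k.1) ((hs k.1).inter (hPmeas k))
      (inter_subset_left.trans (hsV k.1))
      ((hQinj k.1 k.2).mono (inter_subset_right.trans (hPsub k)))
  calc ∑' i, ∫⁻ z in s i, ENNReal.ofReal (‖deriv (a i) z‖ ^ 2)
      ≤ ∑' i, ∑' n, volume (a i '' (s i ∩ P (i, n))) := ENNReal.tsum_le_tsum hstep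
    _ = ∑' k : ι × ℕ, volume (a k.1 '' (s k.1 ∩ P k)) := (ENNReal.tsum_prod (f := fun i n =>
          volume (a i '' (s i ∩ P (i, n))))).symm
    _ = ∑' k : ι × ℕ, ∫⁻ w, (a k.1 '' (s k.1 ∩ P k)).indicator 1 w := by
          refine tsum_congr fun k => ?_
          rw [lintegral_indicator_one (himeas k)]
    _ = ∫⁻ w, ∑' k : ι × ℕ, (a k.1 '' (s k.1 ∩ P k)).indicator 1 w := by
          rw [lintegral_tsum]
          exact fun k => ((measurable_one.indicator (himeas k))).aemeasurable
    _ ≤ ∫⁻ w, d * W.indicator (1 : ℂ → ℝ≥0∞) w := by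
          refine lintegral_mono fun w => ?_
          rw [ENNReal.tsum_eq_iSup_sum]
          exact iSup_le fun F => sum_indicator_image_le hPdisj hd hW F w
    _ = d * volume W := by
          rw [lintegral_const_mul _ (measurable_one.indicator hWm), lintegral_indicator_one hWm]

/-- **Area formula with multiplicity, one map.** If `α` is holomorphic on the open set `U`,
`s ⊆ U` is measurable, `α s ⊆ W` with `W` measurable, and every `w ∈ W` has at most `d`
preimages in `s`, then `∫_s ‖α'‖² ≤ d · area W`. [cite: Federer1969, Thm. 3.2.3] -/
theorem lintegral_norm_deriv_sq_le (hU : IsOpen U) (hα : DifferentiableOn ℂ α U) {s : Set ℂ}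
    (hs : MeasurableSet s) (hsU : s ⊆ U) {W : Set ℂ} (hWm : MeasurableSet W) (hW : MapsTo α s W)
    {d : ℕ} (hd : ∀ w ∈ W, ∃ t : Finset ℂ, t.card ≤ d ∧ s ∩ α ⁻¹' {w} ⊆ ↑t) :
    ∫⁻ z in s, ENNReal.ofReal (‖deriv α z‖ ^ 2) ≤ d * volume W := by
  classical
  have h := tsum_lintegral_norm_deriv_sq_le (ι := Unit) (a := fun _ => α) (V := fun _ => U)
    (fun _ => hU) (fun _ => hα) (s := fun _ => s) (fun _ => hs) (fun _ => hsU) hWm (fun _ => hW)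
    (d := d) ?_
  · simpa only [tsum_fintype, Finset.univ_unique, Finset.sum_singleton] using h
  · intro w hw
    obtain ⟨t, htd, ht⟩ := hd w hw
    refine ⟨t.map ⟨fun z => ((), z), fun z z' h => (Prod.mk.injEq _ _ _ _ ▸ h).2⟩, by simpa using htd,
      fun i z hz hzw => ?_⟩
    rw [Finset.mem_map]
    exact ⟨z, ht ⟨hz, hzw⟩, rfl⟩

end Family

end AreaMultiplicity

end Literature.Analysis.Complex
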